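import Mathlib
import HarnessLib
import Literature.MathematicalPhysics.QuantumManyBody.LangevinGenerator
import Literature.MathematicalPhysics.QuantumManyBody.PeriodicConfigLaplacian
import Literature.MathematicalPhysics.QuantumManyBody.PeriodicFormCoreTrigPoly
import Literature.MathematicalPhysics.QuantumManyBody.DiluteBoseGasUpperBoundLocalization

/-!
# Route `BECNewtonPolicyIteration` — support item `PolicyImprovementIdentity`
# (stmt-AtomisticToContinuum-9319), part 4/5: from the weak Poisson equation to the pointwise
# Newton step (du Bois-Reymond on the torus)

Helper file (`--supports stmt-AtomisticToContinuum-9319`; independent of parts 1–3). The item gives the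
correction `δ` only as a WEAK solution of `∫ ∇δ·∇φ e^{-2S} = ∫ (E_loc - Ē) φ e^{-2S}` (all periodic test
`φ`), but states the policy-improvement identity (i) `E'_loc = Ē - |∇δ|²` POINTWISE; the passage needs
the residual `L_{e^{-S}} δ + E_loc - Ē` to vanish pointwise, i.e. a fundamental lemma on the torus.

* `eq_zero_of_forall_isPeriodicTest_integral_mul_eq_zero` — **du Bois-Reymond against the `C¹`
  periodic core**: a continuous lattice-periodic real `h` with `∫_{cell} φ h = 0` for all periodic test
  `φ` vanishes identically (test with `Re`/`Im` of the plane waves `cellWaveN`: all Fourier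
  coefficients vanish; Parseval `tsum_sq_configFourierCoeff`; continuity,
  `IsTorusPeriodic.eq_zero_of_lintegral_normSq_eq_zero`).
* `newtonStep_of_weakCorrector_of_continuous` — for `S, δ ∈ C²` and a CONTINUOUS bounded interaction
  `W` (e.g. a continuous finite-range profile) the weak equation gives `L_{e^{-S}} δ = -(E_loc - E)`
  everywhere (`IsWeakCorrector.integral_mul_residual_mul_sq` + the lemma above); hence
  `localEnergy_newtonStep_eq_of_continuous`: `E'_loc = E - |∇δ|²` at every point.
* `newtonStep_of_weakCorrector` — the same for `S, δ ∈ C³` and `W ∈ C¹` via the residual-as-test-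
  function argument `IsWeakCorrector.neg_langevinGen_eq` of `LangevinGenerator.lean`.
  (For a merely bounded measurable `W` the identity holds only `dX`-a.e.; not needed here.)

References: R. A. Howard, *Dynamic Programming and Markov Processes* (1960) (policy improvement);
M. L. Puterman, S. L. Brumelle, Math. Oper. Res. 4 (1979) 60 (policy iteration = Newton–Kantorovich);
C. J. Holland, CPAM 31 (1978) 509 (logarithmic transform; min–max for the principal eigenvalue);
J. Barta, C. R. Acad. Sci. Paris 204 (1937) 472 (Barta's inequality `inf (Hφ)/φ ≤ E₀`, `φ > 0`);
W. Thirring, *Quantum Mathematical Physics*, §3.5; [ReedSimonIV1978] §XIII.12; [BakryGentilLedoux2014]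
§1.11.3 (`Γ`-calculus, Green's identity); [KipnisLandim1999] App. 1 §6 (weak Poisson equation);
[Fournais2020] (1.1)–(1.2) (the periodic problem).
-/

noncomputable section

open MeasureTheory Filter Set
open scoped ENNReal NNReal Topology InnerProductSpace ComplexConjugate BigOperators

namespace Summit.AtomisticToContinuum.BoseEinsteinCondensation.Theorems

open Literature.MathematicalPhysics.QuantumManyBody.BoseGas

namespace PolicyImprovement

variable {N : ℕ} {L : ℝ} {v : ℝ → ℝ≥0∞} {Cw : ℝ≥0∞}

section WeakToStrong

variable {S δ : Config N → ℝ}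

/-- `ΔS - |∇S|² ∈ C¹` for `S ∈ C³`. [folklore] -/
theorem contDiff_one_localKinetic (hS : ContDiff ℝ 3 S) : ContDiff ℝ 1 (localKinetic S) := by
  have h2 : ∀ (i : Fin N) (a : Fin 3), ContDiff ℝ 2 (pderiv i a S) := fun i a => contDiff_two_pderiv hS i a
  show ContDiff ℝ 1 fun X => (∑ i : Fin N, ∑ a : Fin 3, pderiv i a (pderiv i a S) X) -
    ∑ i : Fin N, ∑ a : Fin 3, pderiv i a S X * pderiv i a S X
  refine (ContDiff.sum fun i _ => ContDiff.sum fun a _ => contDiff_one_pderiv (h2 i a) i a).sub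
    (ContDiff.sum fun i _ => ContDiff.sum fun a _ => ?_)
  exact ((h2 i a).of_le (by norm_num)).mul ((h2 i a).of_le (by norm_num))

/-- `ΔS - |∇S|²` is lattice periodic when `S` is. [folklore] -/
theorem isLatticePeriodic_localKinetic (hSper : IsLatticePeriodic L S) :
    IsLatticePeriodic L (localKinetic S) := by
  intro X j l
  have h1 : ∀ (i : Fin N) (a : Fin 3),
      pderiv i a (pderiv i a S) (X + Pi.single j (EuclideanSpace.single l L)) = pderiv i a (pderiv i a S) X :=
    fun i a => ((hSper.pderiv i a).pderiv i a) X j l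
  have h2 : ∀ (i : Fin N) (a : Fin 3),
      pderiv i a S (X + Pi.single j (EuclideanSpace.single l L)) = pderiv i a S X :=
    fun i a => (hSper.pderiv i a) X j l
  simp only [localKinetic, configLaplacian, gradDot, h1, h2]

/-- **Weak correctors with smooth data satisfy the Newton step pointwise.** If `S, δ ∈ C³`, the
interaction `W = ∑_{i<j} v^per` is `C¹` and lattice periodic as a real function, and `δ` is a weak
corrector of `E_loc - E` for the weight `e^{-S}` (`E_loc = ΔS - |∇S|² + W`, `E` a constant), then
`L_{e^{-S}} δ = -(E_loc - E)` on the fundamental cell (`IsWeakCorrector.neg_langevinGen_eq`: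
du Bois-Reymond on the torus). This supplies the hypothesis of
`ofReal_sub_le_periodicGroundStateEnergy_of_newtonStep` from the weak equation. [folklore] -/
theorem newtonStep_of_weakCorrector (hL : 0 < L) (hS : ContDiff ℝ 3 S) (hSper : IsLatticePeriodic L S)
    (hδ : ContDiff ℝ 3 δ) (hW1 : ContDiff ℝ 1 fun X : Config N => (periodicInteraction v L X).toReal)
    (hWper : IsLatticePeriodic L fun X : Config N => (periodicInteraction v L X).toReal) {E : ℝ}
    (hcorr : IsWeakCorrector L (fun X => Real.exp (-S X))
      (fun X => localKinetic S X + (periodicInteraction v L X).toReal - E) δ)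
    {X : Config N} (hX : X ∈ cellN N L) :
    langevinGen (fun Y => Real.exp (-S Y)) δ X =
      -(localKinetic S X + (periodicInteraction v L X).toReal - E) := by
  have hF2 : ContDiff ℝ 2 (fun X => Real.exp (-S X)) := (hS.of_le (by norm_num)).neg.exp
  have hFper : IsLatticePeriodic L (fun X => Real.exp (-S X)) := hSper.neg.comp Real.exp
  have hF0 : ∀ X, Real.exp (-S X) ≠ 0 := fun X => (Real.exp_pos _).ne'
  have hg : ContDiff ℝ 1 (fun X => localKinetic S X + (periodicInteraction v L X).toReal - E) :=
    ((contDiff_one_localKinetic hS).add hW1).sub contDiff_const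
  have hgper : IsLatticePeriodic L (fun X => localKinetic S X + (periodicInteraction v L X).toReal - E) :=
    fun Y j l => by
      simp only [(isLatticePeriodic_localKinetic hSper) Y j l, hWper Y j l]
  have h := hcorr.neg_langevinGen_eq hL hF2 hFper hF0 hδ hg hgper hX
  linarith

/-! #### From the weak equation to the pointwise step: du Bois-Reymond on the torus -/

/-- The real part of an `N`-body plane wave is a periodic test function. [folklore] -/
theorem isPeriodicTest_re_cellWaveN (hL : L ≠ 0) (n : Fin N × Fin 3 → ℤ) :
    IsPeriodicTest L (fun X : Config N => (cellWaveN L n X).re) :=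
  ⟨Complex.reCLM.contDiff.comp (contDiff_cellWaveN L n), fun X i k => by
    simp only [cellWaveN_periodic hL n X i k]⟩

/-- The imaginary part of an `N`-body plane wave is a periodic test function. [folklore] -/
theorem isPeriodicTest_im_cellWaveN (hL : L ≠ 0) (n : Fin N × Fin 3 → ℤ) :
    IsPeriodicTest L (fun X : Config N => (cellWaveN L n X).im) :=
  ⟨Complex.imCLM.contDiff.comp (contDiff_cellWaveN L n), fun X i k => by
    simp only [cellWaveN_periodic hL n X i k]⟩

/-- **du Bois-Reymond on the torus against the `C¹` periodic core.** A continuous lattice-periodic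
real `h` with `∫_{cell} φ h = 0` for every periodic test function `φ` vanishes identically: testing
with the real and imaginary parts of the plane waves kills every Fourier coefficient of `h`, so
`∫_{cell} |h|² = 0` by Parseval (`tsum_sq_configFourierCoeff`), and a continuous periodic function
with vanishing `L²` norm is zero (`IsTorusPeriodic.eq_zero_of_lintegral_normSq_eq_zero`). [folklore] -/
theorem eq_zero_of_forall_isPeriodicTest_integral_mul_eq_zero (hL : 0 < L) {h : Config N → ℝ}
    (hc : Continuous h) (hper : IsLatticePeriodic L h)
    (horth : ∀ φ : Config N → ℝ, IsPeriodicTest L φ → ∫ X in cellN N L, φ X * h X = 0)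
    (X : Config N) : h X = 0 := by
  set H : Config N → ℂ := fun Y => ((h Y : ℝ) : ℂ) with hH
  have hHc : Continuous H := Complex.continuous_ofReal.comp hc
  have hHper : IsTorusPeriodic L H := fun Y i k => by simp only [hH, hper Y i k]
  -- every Fourier coefficient of `H` vanishes
  have hcoeff : ∀ n, configFourierCoeff L H n = 0 := by
    intro n
    rw [configFourierCoeff_eq_integral hL hHc.aestronglyMeasurable]
    have hre := horth _ (isPeriodicTest_re_cellWaveN hL.ne' n)
    have him := horth _ (isPeriodicTest_im_cellWaveN hL.ne' n)
    have hpt : ∀ Y, conj (cellWaveN L n Y) * H Y =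
        (((cellWaveN L n Y).re * h Y : ℝ) : ℂ) - Complex.I * (((cellWaveN L n Y).im * h Y : ℝ) : ℂ) := by
      intro Y
      apply Complex.ext <;> simp [hH]
    have hi1 : IntegrableOn (fun Y => (((cellWaveN L n Y).re * h Y : ℝ) : ℂ)) (cellN N L) volume :=
      integrableOn_cellN (Complex.continuous_ofReal.comp
        ((Complex.continuous_re.comp (continuous_cellWaveN L n)).mul hc)) L
    have hi2 : IntegrableOn (fun Y => Complex.I * (((cellWaveN L n Y).im * h Y : ℝ) : ℂ)) (cellN N L)
        volume :=
      integrableOn_cellN (continuous_const.mul (Complex.continuous_ofReal.comp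
        ((Complex.continuous_im.comp (continuous_cellWaveN L n)).mul hc))) L
    simp_rw [hpt]
    rw [integral_sub hi1 hi2, integral_const_mul, integral_complex_ofReal, integral_complex_ofReal,
      hre, him]
    simp
  -- Parseval: the `L²` norm of `H` on the cell vanishes
  have hpars := tsum_sq_configFourierCoeff hL hHc
  simp only [hcoeff, nnnorm_zero, ENNReal.coe_zero, zero_pow two_ne_zero, tsum_zero] at hpars
  have hc0 : ((ENNReal.ofReal L ^ 3)⁻¹) ^ N ≠ 0 :=
    pow_ne_zero _ (ENNReal.inv_ne_zero.2 (ENNReal.pow_ne_top ENNReal.ofReal_ne_top))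
  have h0 : ∫⁻ Y in cellN N L, (‖H Y‖₊ : ℝ≥0∞) ^ 2 = 0 := (mul_eq_zero.1 hpars.symm).resolve_left hc0
  have hX := hHper.eq_zero_of_lintegral_normSq_eq_zero hL hHc h0 X
  simpa [hH] using hX

/-- **Weak correctors satisfy the Newton step pointwise when the interaction is continuous.** For
`S, δ ∈ C²` (`S` lattice periodic), a continuous real interaction `W = ∑_{i<j} v^per` and a constant
`E`: if `δ` is a weak corrector of `E_loc - E` for the weight `e^{-S}` then
`L_{e^{-S}} δ = -(E_loc - E)` everywhere (the continuous periodic residual `(L δ + E_loc - E) e^{-2S}`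
is orthogonal to the test core, `IsWeakCorrector.integral_mul_residual_mul_sq`, hence zero by
`eq_zero_of_forall_isPeriodicTest_integral_mul_eq_zero`). [folklore] -/
theorem newtonStep_of_weakCorrector_of_continuous (hL : 0 < L)
    (hVc : Continuous fun X : Config N => (periodicInteraction v L X).toReal) (hS : ContDiff ℝ 2 S)
    (hSper : IsLatticePeriodic L S) (hδ : ContDiff ℝ 2 δ) {E : ℝ}
    (hcorr : IsWeakCorrector L (fun X => Real.exp (-S X))
      (fun X => localKinetic S X + (periodicInteraction v L X).toReal - E) δ) (X : Config N) :
    langevinGen (fun Y => Real.exp (-S Y)) δ X =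
      -(localKinetic S X + (periodicInteraction v L X).toReal - E) := by
  have hS1 : ContDiff ℝ 1 S := hS.of_le (by norm_num)
  have hδper : IsLatticePeriodic L δ := hcorr.isPeriodicTest.isLatticePeriodic
  have hF1 : ContDiff ℝ 1 (fun X => Real.exp (-S X)) := hS1.neg.exp
  have hFper : IsLatticePeriodic L (fun X => Real.exp (-S X)) := hSper.neg.comp Real.exp
  have hF0 : ∀ X, Real.exp (-S X) ≠ 0 := fun X => (Real.exp_pos _).ne'
  have hlk : Continuous (localKinetic S) :=
    (continuous_finsetSum _ fun i _ => continuous_finsetSum _ fun a _ =>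
      continuous_pderiv (contDiff_one_pderiv hS i a) i a).sub (continuous_gradDot hS1 hS1)
  have hg : Continuous fun X => localKinetic S X + (periodicInteraction v L X).toReal - E :=
    (hlk.add hVc).sub continuous_const
  have hWper : IsLatticePeriodic L fun X : Config N => (periodicInteraction v L X).toReal :=
    fun Y i k => by simp only [periodicInteraction_add_single]
  -- the residual times the density
  set r : Config N → ℝ := fun Y => (langevinGen (fun Z => Real.exp (-S Z)) δ Y +
    (localKinetic S Y + (periodicInteraction v L Y).toReal - E)) * Real.exp (-S Y) ^ 2 with hr
  have hrc : Continuous r := ((continuous_langevinGen hF1 hF0 hδ).add hg).mul (hF1.continuous.pow 2)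
  have hrper : IsLatticePeriodic L r := fun Y i k => by
    simp only [hr, (hFper.langevinGen hδper) Y i k, (isLatticePeriodic_localKinetic hSper) Y i k,
      hWper Y i k, hFper Y i k]
  have horth : ∀ φ : Config N → ℝ, IsPeriodicTest L φ → ∫ Y in cellN N L, φ Y * r Y = 0 := by
    intro φ hφ
    have h := hcorr.integral_mul_residual_mul_sq hL hF1 hFper hF0 hδ hg hφ
    rw [← h]
    exact integral_congr_ae (Eventually.of_forall fun Y => by simp only [hr]; ring)
  have h0 := eq_zero_of_forall_isPeriodicTest_integral_mul_eq_zero hL hrc hrper horth X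
  simp only [hr, mul_eq_zero, pow_eq_zero_iff two_ne_zero, hF0 X, or_false] at h0
  linarith

/-- **Policy-improvement identity, pointwise, from the weak equation** (continuous interaction,
`C²` data): under the hypotheses of `newtonStep_of_weakCorrector_of_continuous` with `E = Ē`, the
local energy of `e^{-(S+δ)}` is EXACTLY `Ē - |∇δ|²` at every point. [folklore] -/
theorem localEnergy_newtonStep_eq_of_continuous (hL : 0 < L)
    (hVc : Continuous fun X : Config N => (periodicInteraction v L X).toReal) (hS : ContDiff ℝ 2 S)
    (hSper : IsLatticePeriodic L S) (hδ : ContDiff ℝ 2 δ) {E : ℝ}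
    (hcorr : IsWeakCorrector L (fun X => Real.exp (-S X))
      (fun X => localKinetic S X + (periodicInteraction v L X).toReal - E) δ) (X : Config N) :
    localKinetic (S + δ) X + (periodicInteraction v L X).toReal = E - gradDot δ δ X :=
  localKinetic_add_of_newtonStep (V := fun Y => (periodicInteraction v L Y).toReal) hS hδ
    (newtonStep_of_weakCorrector_of_continuous hL hVc hS hSper hδ hcorr X)

end WeakToStrong

end PolicyImprovement

end Summit.AtomisticToContinuum.BoseEinsteinCondensation.Theorems

end
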